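import Summits.BirchSwinnertonDyer.BirchSwinnertonDyer.Theorems.SchneiderFreeUpperSockets
import Summits.BirchSwinnertonDyer.BirchSwinnertonDyer.Theorems.SchneiderFreeAdditiveX3JointLowerIdentity
import Summits.BirchSwinnertonDyer.BirchSwinnertonDyer.Theorems.SchneiderFreeAdditiveX3JointLowerTransport
import Summits.BirchSwinnertonDyer.Rank1Residual.AdditivePotMult.RankOneHeegnerAnyPrime
import Summits.BirchSwinnertonDyer.Rank1Residual.X11b.Three.StepLAtThree
import Literature.NumberTheory.EllipticCurves.Wuthrich2014.ShaBoundProofs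
import Literature.NumberTheory.EllipticCurves.Rank1Residual.Typed.JointLower
import HarnessLib

/-!
# Schneider-free additive X3 door, SECOND WING — co-Gross–Zagier bookkeeping: co-STEP L ⟹ the JOINT upper
# half over `(E, E^{d_K})`, and the per-curve assembly with the TWIST-UNIT lever (Theses-free)

Cell `bsd-schneider-ideate`. The two theorems are the base unit's (planner P2 gen 13) kernel-checked Sketch
`memos/ROUTE-P2-upper-v1-g13-Sketch.lean` §4 and §5 (assembly) VERBATIM (memo
`memos/ROUTE-P2-upper-v1-g13.md` U9, U11), landed by seat `bsd-schneider-door-c5` (prover, gen 8; the GZ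
bookkeeping of the door — item 19180 `JointLowerManin` — is this seat's gen 0, and this is its mirror).
CONDITIONAL on the named facts carried as hypotheses (Gross–Zagier I.(6.3), Kolyvagin, GZK, modularity,
Gross–Zagier I.(7.3) — conjuncts 1–4 and 7 of the route's `PrintedFacts`); nothing is asserted about BSD;
no item is closed.

* `jointUpperBoundAt_of_coStepL_manin` — the mirror of the CLOSED item 19180: facts → B6 Heegner/twist data →
  `p ∣ N` → `p ≠ 2` → co-STEP L at slack `v_p(Dt.c)` (`Upper.IndexUpperBoundLeAt`) → `Upper.JointUpperBoundAt W Wd p`.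
  Proof = 19180's with the two transports used as the tree's EQUALITIES
  (`X2.padicValNat_tamagawaProduct_twist_of_heegner_of_odd`, `AdditivePotMult.padicValRat_u_eq_zero_of_twist_minimal_of_split`
  — the second needs `p ∣ N`, true on the additive cells) and the inequality reversed; the `2·v_p(c)` cancel.
* `missingUpperBoundAt_of_coStepL_of_twistUnit` — per-curve assembly: facts → `r_an = 1` → `p ≠ 2` →
  `N10.Locus` → `p ∣ N_E` → `Upper.AdditiveCoStepLInputManinAt W p` → `Upper.TwistUnitHeegnerDataAt W p` →
  `MissingUpperBoundAt W p` (the UPPER half of BSD_p at `(W, p)`), via `missingUpperBoundAt_of_jointUpper_of_twistUnit`.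

References: [GrossZagier1986] Thm. I.(6.3), (7.3); [JetchevSkinnerWan2017] §7.4.1 (arXiv:1512.06894 p. 30);
[Miller2011LMS] Def. 1.1; [Vatsal1999] Thm. 0.3 (the twist-unit lever's literature, not used here).
-/

noncomputable section

open scoped Classical

open WeierstrassCurve NumberField IsDedekindDomain Field Literature.NumberTheory.EllipticCurves
  Literature.NumberTheory.EllipticCurves.ModularForms
  Literature.NumberTheory.EllipticCurves.GreenbergSelmer
  Literature.NumberTheory.EllipticCurves.Rank1Residual
  Literature.NumberTheory.EllipticCurves.Rank1Residual.Typed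
  Literature.NumberTheory.EllipticCurves.KellerYin2024
  Summit.BirchSwinnertonDyer.Rank1Residual
  Summit.BirchSwinnertonDyer.Rank1Residual.X11b
  Summit.BirchSwinnertonDyer.Rank1Residual.X11b.AcSelmer
  Summit.BirchSwinnertonDyer.Rank1Residual.X11b.Halves

set_option linter.dupNamespace false
set_option autoImplicit false

namespace Summit.BirchSwinnertonDyer.BirchSwinnertonDyer.Theorems.SchneiderFree.Upper

/-! ### §1 co-Gross–Zagier bookkeeping: co-STEP L ⟹ the JOINT upper half (mirror of item 19180) -/

/-- **co-STEP L at slack `v_p(c)` ⟹ JOINT upper, kernel-checked** — the mirror of the CLOSED route item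
`JointLowerManin` (19180, `schneiderFreeAdditiveX3_jointLowerManin_proof`): the tree's exact identity
`exists_shaAn_padicVal_eq_of_heegner_manin` (`ord q + ord q_d + ord ∏c(E) + 2 ord #E^d(ℚ)_tors + 2 v_p(c) + v_p(u)
= 2 ord [E(K):ℤP]`), Gross–Zagier I.(7.3) for the twist's value, `#Ш_an(E^d) = q_d·#tors²/∏c(E^d)`, and the two
twist transports as EQUALITIES (`X2.padicValNat_tamagawaProduct_twist_of_heegner_of_odd`,
`AdditivePotMult.padicValRat_u_eq_zero_of_twist_minimal_of_split` — the second one needs `p ∣ N`, true on the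
additive cells). Facts by name as hypotheses (conjuncts 1–4 and 7 of the route's `PrintedFacts`).
[cite: GrossZagier1986, Thm. I.(6.3) and (7.3)] [cite: JetchevSkinnerWan2017, §7.4.1 (arXiv:1512.06894 p. 30)] -/
theorem jointUpperBoundAt_of_coStepL_manin
    (hGZ : ∀ (N : ℕ) [NeZero N] (W : WeierstrassCurve ℚ) (K : Type) [Field K] [NumberField K],
      gross_zagier N W K)
    (hKo : ∀ (N : ℕ) [NeZero N] (W : WeierstrassCurve ℚ) (K : Type) [Field K] [NumberField K],
      kolyvagin N W K)
    (hGZK : rank_eq_analyticRank_of_analyticRank_le_one) (hmod : hasEntireLFunction_rat)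
    (hGZ73 : GrossZagier1986_thm_I_7_3)
    (W : WeierstrassCurve ℚ) [W.IsElliptic] [W.IsGloballyMinimal] (p : ℕ) [Fact p.Prime]
    (N : ℕ) [NeZero N] (K : Type) [Field K] [NumberField K]
    (Dt : ModularParametrizationData W N) (H : HeegnerDatum N (NumberField.discr K)) (ι : K →+* ℂ)
    (P : (W.baseChange K).toAffine.Point) (Wd : WeierstrassCurve ℚ) [Wd.IsElliptic] [Wd.IsGloballyMinimal]
    (hr : W.analyticRank = 1) (hN : W.conductorNorm ℤ = N) (hpN : p ∣ N) (hK : IsImaginaryQuadratic K)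
    (hodd : Odd (NumberField.discr K)) (hw : ¬ p ∣ Units.torsionOrder K)
    (hHH : SatisfiesHeegnerHypothesis N K)
    (hLd : (W.quadraticTwist (NumberField.discr K : ℚ)).entireLFunction 1 ≠ 0)
    (hP : WeierstrassCurve.Affine.Point.map ι.toRatAlgHom P = heegnerPointComplex Dt H)
    (hC : ∃ C : VariableChange ℚ, C • W.quadraticTwist (NumberField.discr K : ℚ) = Wd)
    (hp2 : p ≠ 2) (hI : IndexUpperBoundLeAt W p K P (padicValNat p Dt.c.natAbs)) :
    JointUpperBoundAt W Wd p := by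
  have hpp : p.Prime := Fact.out
  obtain ⟨Cd, hWd⟩ := hC
  -- the twist's algebraic central value (Gross–Zagier I.(7.3))
  obtain ⟨qd, hqd⟩ := SchneiderFree.exists_rat_twist_L_one_div_realPeriod_of_heegner W N K Dt H ι P
    (hGZ N W K) (hKo N W K) hGZK hmod hGZ73 hK hHH hP hr hLd Wd Cd hWd
  -- the Manin-robust bookkeeping identity (an EQUALITY: it serves both wings)
  obtain ⟨-, -, hsha, q, hq, hval⟩ := SchneiderFree.exists_shaAn_padicVal_eq_of_heegner_manin W p N K
    Dt H ι P (hGZ N W K) (hKo N W K) hGZK hmod hK hHH hP hp2 hw hr hLd Wd Cd hWd qd hqd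
  -- `#Ш_an(E^{d_K})` in rank zero
  have hD0 : (NumberField.discr K : ℚ) ≠ 0 := by exact_mod_cast NumberField.discr_ne_zero K
  haveI : (W.quadraticTwist (NumberField.discr K : ℚ)).IsElliptic := W.isElliptic_quadraticTwist hD0
  have hLd1 : Wd.entireLFunction 1 ≠ 0 := by rw [← hWd, entireLFunction_smul]; exact hLd
  obtain ⟨-, hfin, -, hshaAnd⟩ := Wuthrich2014.shaAn_eq_of_L_one_div_eq hGZK Wd hLd1 hqd
  haveI := hfin
  have htdeq : Wd.torsionOrder = Nat.card Wd.toAffine.Point := Wd.torsionOrder_eq_natCard_of_finite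
  -- the two transports, as EQUALITIES (`p` odd, `p ∣ N` split in `K`)
  have hHN' : SatisfiesHeegnerHypothesis (W.conductorNorm ℤ) K := by rw [hN]; exact hHH
  have hHp : SatisfiesHeegnerHypothesis p K := SatisfiesHeegnerHypothesis.of_dvd hpN hHH
  have hpd : ¬ (p : ℤ) ∣ NumberField.discr K :=
    X11b.Three.not_dvd_discr_of_ncard_primesOver_eq_two hK.1 hp2 (hHH p hpp hpN)
  have htam := X2.padicValNat_tamagawaProduct_twist_of_heegner_of_odd W p hp2 K hK hodd hpd hHN' Cd hWd
  have hu := AdditivePotMult.padicValRat_u_eq_zero_of_twist_minimal_of_split W p K hK hHp Cd hWd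
  -- the joint upper half
  refine ⟨q, qd * (Nat.card Wd.toAffine.Point : ℚ) ^ 2 / (Wd.tamagawaProduct : ℚ), hq, hshaAnd, ?_⟩
  have hqd0 : qd ≠ 0 := by
    intro h0
    apply hLd1
    have hΩ : (Wd.realPeriodRat : ℂ) ≠ 0 := by exact_mod_cast Wd.realPeriodRat_pos_holds.ne'
    rw [h0, Rat.cast_zero, div_eq_zero_iff] at hqd
    exact hqd.resolve_right hΩ
  have htd0 : (Nat.card Wd.toAffine.Point : ℚ) ≠ 0 := by exact_mod_cast (Nat.card_pos).ne'
  have hcd0 : (Wd.tamagawaProduct : ℚ) ≠ 0 := by exact_mod_cast Wd.tamagawaProduct_pos_holds.ne'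
  have hvd : padicValRat p (qd * (Nat.card Wd.toAffine.Point : ℚ) ^ 2 / (Wd.tamagawaProduct : ℚ)) =
      padicValRat p qd + 2 * padicValNat p Wd.torsionOrder - padicValNat p Wd.tamagawaProduct := by
    rw [padicValRat.div (mul_ne_zero hqd0 (pow_ne_zero _ htd0)) hcd0, padicValRat.mul hqd0 (pow_ne_zero _ htd0),
      padicValRat.pow, padicValRat.of_nat, padicValRat.of_nat, htdeq]
    push_cast; ring
  rw [hvd]
  unfold IndexUpperBoundLeAt at hI
  have e1 : (padicValNat p (W.baseChange K).shaOrder : ℤ) + 2 * padicValNat p W.tamagawaProduct +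
      2 * padicValNat p Dt.c.natAbs ≤ 2 * padicValNat p (AddSubgroup.zmultiples P).index := by exact_mod_cast hI
  have e2 : (padicValNat p (W.baseChange K).shaOrder : ℤ) =
      padicValNat p W.shaOrder + padicValNat p Wd.shaOrder := by exact_mod_cast hsha
  have e3 : (padicValNat p Wd.tamagawaProduct : ℤ) = padicValNat p W.tamagawaProduct := by exact_mod_cast htam
  linarith


/-! ### §2 The upper half at ONE pair from co-STEP L and a twist-unit datum at that curve -/

/-- **The upper wing at ONE pair from its typed inputs AT THAT CURVE (kernel-checked assembly).** For a curve
run through the co-chain itself (a GOOD member: the co-sockets are asked of `W`), the printed facts, co-STEP L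
at `W` and a twist-unit Heegner datum at `W` give the UPPER half at `W`. (For a bad member the wing goes
through a good member `W₁` of the isogeny class and Cassels' invariance `bsdRHS_eq_of_isIsogenous` — memo §4.)
[cite: GrossZagier1986, Thm. I.(6.3)] [cite: Miller2011LMS, Def. 1.1] -/
theorem missingUpperBoundAt_of_coStepL_of_twistUnit
    (hGZ : ∀ (N : ℕ) [NeZero N] (W : WeierstrassCurve ℚ) (K : Type) [Field K] [NumberField K],
      gross_zagier N W K)
    (hKo : ∀ (N : ℕ) [NeZero N] (W : WeierstrassCurve ℚ) (K : Type) [Field K] [NumberField K],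
      kolyvagin N W K)
    (hGZK : rank_eq_analyticRank_of_analyticRank_le_one) (hmod : hasEntireLFunction_rat)
    (hGZ73 : GrossZagier1986_thm_I_7_3)
    (W : WeierstrassCurve ℚ) [W.IsElliptic] [W.IsGloballyMinimal] (p : ℕ) [Fact p.Prime]
    (hr : W.analyticRank = 1) (hp2 : p ≠ 2) (hLoc : Additive.N10.Locus W p)
    (hpN : p ∣ W.conductorNorm ℤ)
    (hco : AdditiveCoStepLInputManinAt W p) (hT : TwistUnitHeegnerDataAt W p) :
    MissingUpperBoundAt W p := by
  obtain ⟨N, _, K, _, _, Dt, H, ι, P, Wd, _, _, hN, hK, hodd, hw, hHH, hLd, hP, hnt, htf, hC, hunit⟩ := hT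
  have hI : IndexUpperBoundLeAt W p K P (padicValNat p Dt.c.natAbs) :=
    hco N K Dt H ι P hr hLoc hN hK hodd hw hHH hLd hP hnt htf
  have hJ : JointUpperBoundAt W Wd p :=
    jointUpperBoundAt_of_coStepL_manin hGZ hKo hGZK hmod hGZ73 W p N K Dt H ι P Wd hr hN (hN ▸ hpN) hK hodd
      hw hHH hLd hP hC hp2 hI
  exact missingUpperBoundAt_of_jointUpper_of_twistUnit hJ hunit

end Summit.BirchSwinnertonDyer.BirchSwinnertonDyer.Theorems.SchneiderFree.Upper

end
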